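import Summits.AtomisticToContinuum.HydrodynamicLimit.Theorems.CollisionIsometryCLTAdaptedWeightCLTBHDVTransferChaos

/-!
# DV transfer for the line `block-h-dissipation-closure` (crux `AdaptedWeightCLT`, stmt-AtomisticToContinuum-14868),
# file 4: the smeared contact density `contactDens` has mass `contactMass`

Support file (`--supports stmt-AtomisticToContinuum-14868`, anchor `bhDVTransfer_contact_anchor`) of the line lead
`prover-line-stmt-AtomisticToContinuum-14868-c4-0`, written for the registered stub `stub_dvTransfer` (S2): the
bookkeeping of the lifted smeared contact law of a (cell, window) along a hard-sphere orbit.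

* `finite_collisionTimes_win` — on the good set of the flow, the collision times in a window `win γc N t k` are
  finitely many (`IsHardSphereTrajectory.locFinite`), so every `collisionPairSum` over a window is an honest finite
  sum (`contactDens_eq_sum`, `contactMass_eq_sum`);
* `contactDens_nonneg`, `contactMass_nonneg` (nonnegative kernel family), `continuous_contactDens`,
  `integrable_contactDens` and the MASS IDENTITY `integral_contactDens` : `∫_{Quad} contactDens dy = contactMass`
  (`h ≠ 0`) — each contact contributes `ψ_N(x_a − x) ∫ G_h^{⊗4} = ψ_N(x_a − x)`;
* `contactDens_eq_zero_of_contactMass_eq_zero`: a window with no charged contact has `contactDens ≡ 0`.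

No definitions. The configuration-space facts about `chaosDens` are in file 3 (`…BHDVTransferChaos`).
-/

namespace Summit.AtomisticToContinuum.HydrodynamicLimit.Theorems.BlockHDissipation

open scoped BigOperators Topology Classical MeasureTheory ENNReal InnerProductSpace
open Filter Set MeasureTheory Real
open Literature.Analysis.FluidPDE
open Summit.AtomisticToContinuum.HydrodynamicLimit.Theorems.ContactSourceDuhamel (T3 V3 Cfg Vel Flow Flows)
open Literature.MathematicalPhysics.KineticTheory (hsDiameter collide hardSphereKernel sphereMeasure)

noncomputable section

namespace DVTransfer

variable {σ : ℝ} {N : ℕ}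

/-- The windows are contained in closed bounded intervals. -/
theorem win_subset_Icc (γc : ℝ) (N : ℕ) (t : ℝ) (k : ℕ) :
    win γc N t k ⊆ Icc ((k : ℝ) * winW γc N) (((k : ℝ) + 1) * winW γc N) :=
  fun _ hs => ⟨hs.1.1.le, hs.1.2⟩

/-- **Finitely many collisions per window on the good set**: for `z ∈ Φ.good` the collision times of the orbit
in the window `win γc N t k` are finitely many. -/
theorem finite_collisionTimes_win (Φ : Flow σ N) {z : Cfg N} (hz : z ∈ Φ.good) (γc t : ℝ) (k : ℕ) :
    (collisionTimes (Torus.geometry (Fin 3)) (hsDiameter σ N) (fun s => Φ.flow s z) ∩ win γc N t k).Finite :=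
  ((Φ.isTrajectory z hz).locFinite _ _).subset
    (inter_subset_inter_right _ (win_subset_Icc γc N t k))

/-- The smeared contact density as an honest finite sum over the collision times of the window. -/
theorem contactDens_eq_sum (Φ : Flow σ N) (ψ : ℕ → T3 → ℝ) (γc h t : ℝ) (z : Cfg N) (k : ℕ) (x : T3)
    (hfin : (collisionTimes (Torus.geometry (Fin 3)) (hsDiameter σ N) (fun s => Φ.flow s z) ∩ win γc N t k).Finite)
    (y : Quad) :
    contactDens σ N Φ ψ γc h t z k x y = ∑ s ∈ hfin.toFinset,
      ∑ p ∈ contactPairs (Torus.geometry (Fin 3)) (hsDiameter σ N) (Φ.flow s z),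
        cw N ψ (Φ.flow s z) x p.1 * gauss4 h (quadOf N (Φ.flow s z) p.1 p.2) y := by
  unfold contactDens HardSphereFlow.collisionPairSum
  exact collisionPairSum_eq_finset_sum hfin _

/-- The contact mass as an honest finite sum over the collision times of the window. -/
theorem contactMass_eq_sum (Φ : Flow σ N) (ψ : ℕ → T3 → ℝ) (γc t : ℝ) (z : Cfg N) (k : ℕ) (x : T3)
    (hfin : (collisionTimes (Torus.geometry (Fin 3)) (hsDiameter σ N) (fun s => Φ.flow s z) ∩ win γc N t k).Finite) :
    contactMass σ N Φ ψ γc t z k x = ∑ s ∈ hfin.toFinset,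
      ∑ p ∈ contactPairs (Torus.geometry (Fin 3)) (hsDiameter σ N) (Φ.flow s z), cw N ψ (Φ.flow s z) x p.1 := by
  unfold contactMass HardSphereFlow.collisionPairSum
  exact collisionPairSum_eq_finset_sum hfin _

/-- The contact mass is nonnegative (nonnegative kernel family; finitely many collisions in the window). -/
theorem contactMass_nonneg {ψ : ℕ → T3 → ℝ} (hψ : ∀ N y, 0 ≤ ψ N y) (Φ : Flow σ N) (γc t : ℝ) (z : Cfg N)
    (k : ℕ) (x : T3)
    (hfin : (collisionTimes (Torus.geometry (Fin 3)) (hsDiameter σ N) (fun s => Φ.flow s z) ∩ win γc N t k).Finite) :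
    0 ≤ contactMass σ N Φ ψ γc t z k x := by
  rw [contactMass_eq_sum Φ ψ γc t z k x hfin]
  exact Finset.sum_nonneg fun s _ => Finset.sum_nonneg fun p _ => cw_nonneg hψ N _ x _

/-- The smeared contact density is nonnegative (nonnegative kernel family, `h ≠ 0`; finitely many collisions). -/
theorem contactDens_nonneg {ψ : ℕ → T3 → ℝ} (hψ : ∀ N y, 0 ≤ ψ N y) (Φ : Flow σ N) (γc : ℝ) {h : ℝ} (hh : h ≠ 0)
    (t : ℝ) (z : Cfg N) (k : ℕ) (x : T3)
    (hfin : (collisionTimes (Torus.geometry (Fin 3)) (hsDiameter σ N) (fun s => Φ.flow s z) ∩ win γc N t k).Finite)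
    (y : Quad) : 0 ≤ contactDens σ N Φ ψ γc h t z k x y := by
  rw [contactDens_eq_sum Φ ψ γc h t z k x hfin]
  exact Finset.sum_nonneg fun s _ => Finset.sum_nonneg fun p _ =>
    mul_nonneg (cw_nonneg hψ N _ x _) (gauss4_pos hh _ _).le

/-- The smeared contact density is continuous on `Quad` (finitely many collisions in the window). -/
theorem continuous_contactDens (Φ : Flow σ N) (ψ : ℕ → T3 → ℝ) (γc h t : ℝ) (z : Cfg N) (k : ℕ) (x : T3)
    (hfin : (collisionTimes (Torus.geometry (Fin 3)) (hsDiameter σ N) (fun s => Φ.flow s z) ∩ win γc N t k).Finite) :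
    Continuous (contactDens σ N Φ ψ γc h t z k x) := by
  have e : contactDens σ N Φ ψ γc h t z k x = fun y => ∑ s ∈ hfin.toFinset,
      ∑ p ∈ contactPairs (Torus.geometry (Fin 3)) (hsDiameter σ N) (Φ.flow s z),
        cw N ψ (Φ.flow s z) x p.1 * gauss4 h (quadOf N (Φ.flow s z) p.1 p.2) y :=
    funext fun y => contactDens_eq_sum Φ ψ γc h t z k x hfin y
  rw [e]
  refine continuous_finsetSum _ fun s _ => continuous_finsetSum _ fun p _ => ?_
  exact continuous_const.mul (continuous_gauss4 h _)

/-- The smeared contact density is integrable on `Quad` (`h ≠ 0`; finitely many collisions in the window). -/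
theorem integrable_contactDens (Φ : Flow σ N) (ψ : ℕ → T3 → ℝ) (γc : ℝ) {h : ℝ} (hh : h ≠ 0) (t : ℝ) (z : Cfg N)
    (k : ℕ) (x : T3)
    (hfin : (collisionTimes (Torus.geometry (Fin 3)) (hsDiameter σ N) (fun s => Φ.flow s z) ∩ win γc N t k).Finite) :
    Integrable (contactDens σ N Φ ψ γc h t z k x) := by
  have e : contactDens σ N Φ ψ γc h t z k x = fun y => ∑ s ∈ hfin.toFinset,
      ∑ p ∈ contactPairs (Torus.geometry (Fin 3)) (hsDiameter σ N) (Φ.flow s z),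
        cw N ψ (Φ.flow s z) x p.1 * gauss4 h (quadOf N (Φ.flow s z) p.1 p.2) y :=
    funext fun y => contactDens_eq_sum Φ ψ γc h t z k x hfin y
  rw [e]
  refine integrable_finsetSum _ fun s _ => integrable_finsetSum _ fun p _ => ?_
  exact (integrable_gauss4 hh _).const_mul _

/-- **Mass identity**: `∫_{Quad} contactDens dy = contactMass` (`h ≠ 0`; finitely many collisions in the
window) — each charged contact contributes `ψ_N(x_a − x) · ∫ G_h^{⊗4} = ψ_N(x_a − x)`. -/
theorem integral_contactDens (Φ : Flow σ N) (ψ : ℕ → T3 → ℝ) (γc : ℝ) {h : ℝ} (hh : h ≠ 0) (t : ℝ) (z : Cfg N)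
    (k : ℕ) (x : T3)
    (hfin : (collisionTimes (Torus.geometry (Fin 3)) (hsDiameter σ N) (fun s => Φ.flow s z) ∩ win γc N t k).Finite) :
    ∫ y, contactDens σ N Φ ψ γc h t z k x y = contactMass σ N Φ ψ γc t z k x := by
  have e : contactDens σ N Φ ψ γc h t z k x = fun y => ∑ s ∈ hfin.toFinset,
      ∑ p ∈ contactPairs (Torus.geometry (Fin 3)) (hsDiameter σ N) (Φ.flow s z),
        cw N ψ (Φ.flow s z) x p.1 * gauss4 h (quadOf N (Φ.flow s z) p.1 p.2) y :=
    funext fun y => contactDens_eq_sum Φ ψ γc h t z k x hfin y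
  rw [e, contactMass_eq_sum Φ ψ γc t z k x hfin,
    integral_finsetSum _ (fun s _ => integrable_finsetSum _ fun p _ => (integrable_gauss4 hh _).const_mul _)]
  refine Finset.sum_congr rfl fun s _ => ?_
  rw [integral_finsetSum _ (fun p _ => (integrable_gauss4 hh _).const_mul _)]
  refine Finset.sum_congr rfl fun p _ => ?_
  rw [integral_const_mul, integral_gauss4 hh, mul_one]

/-- A window without charged contacts (`contactMass = 0`) has `contactDens ≡ 0` (nonnegative kernel family;
finitely many collisions): every charged weight `ψ_N(x_a − x)` vanishes. -/
theorem contactDens_eq_zero_of_contactMass_eq_zero {ψ : ℕ → T3 → ℝ} (hψ : ∀ N y, 0 ≤ ψ N y) (Φ : Flow σ N)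
    (γc h t : ℝ) (z : Cfg N) (k : ℕ) (x : T3)
    (hfin : (collisionTimes (Torus.geometry (Fin 3)) (hsDiameter σ N) (fun s => Φ.flow s z) ∩ win γc N t k).Finite)
    (h0 : contactMass σ N Φ ψ γc t z k x = 0) (y : Quad) : contactDens σ N Φ ψ γc h t z k x y = 0 := by
  rw [contactMass_eq_sum Φ ψ γc t z k x hfin] at h0
  rw [contactDens_eq_sum Φ ψ γc h t z k x hfin]
  have hs := (Finset.sum_eq_zero_iff_of_nonneg (fun s _ => Finset.sum_nonneg fun p _ => cw_nonneg hψ N _ x _)).1 h0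
  refine Finset.sum_eq_zero fun s hs' => ?_
  have hp := (Finset.sum_eq_zero_iff_of_nonneg (fun p _ => cw_nonneg hψ N _ x _)).1 (hs s hs')
  refine Finset.sum_eq_zero fun p hp' => ?_
  rw [hp p hp', zero_mul]

end DVTransfer

/-! ## Registered anchor of this support file -/

/-- ANCHOR (registered helper stub `bhDVTransfer_contact_anchor` of the crux item): the mass identity of the lifted
smeared contact law — for `h ≠ 0`, along any hard-sphere flow, for every initial datum in the good set,
`∫_{Quad} contactDens dy = contactMass` for every window `k` and location `x`. -/
theorem bhDVTransfer_contact_anchor : ∀ (σ : ℝ) (N : ℕ) (Φ : Flow σ N) (ψ : ℕ → T3 → ℝ) (γc h t : ℝ), h ≠ 0 → ∀ (z : Cfg N), z ∈ Φ.good → ∀ (k : ℕ) (x : T3), ∫ y, contactDens σ N Φ ψ γc h t z k x y = contactMass σ N Φ ψ γc t z k x :=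
  fun _ _ Φ ψ γc _ t hh z hz k x =>
    DVTransfer.integral_contactDens Φ ψ γc hh t z k x (DVTransfer.finite_collisionTimes_win Φ hz γc t k)

end

end Summit.AtomisticToContinuum.HydrodynamicLimit.Theorems.BlockHDissipation
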